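import Mathlib
import Summits.Parity.BatemanHorn.Theses.AlmostPrimeZeros

/-!
# Sketch — first lemmas for the crux-idea cards on `SystemLSDRealSegment` (stmt-Parity-11292)

Card A (`sign-free-sieve-lab`): `SignFreeSlack`, `OnePointLawVisible`, `OnePointLawBeyond`, `LSDBracket`.
Card B (`reflection-damped-cofactor`): `reflection_identity` (finite identity, squarefree case),
`SecondGenerationAggregate`.
All statements are `Prop`s / sorried finite identities over Mathlib + the route file; nothing here is a
route item.
-/

namespace Summit.Parity.BatemanHorn.Cruxes.SystemLSDRealSegment.Sketch

open scoped BigOperators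
open Finset Filter

/-! ## Card B: the reflection (double-switching) identity -/

/-- Visible part at level `L`: `A_L(m) = ∑_{d ∣ m, d ≤ L} (y-1)^{ω(d)}`. -/
noncomputable def visA (y L : ℝ) (m : ℕ) : ℝ :=
  ∑ d ∈ m.divisors.filter (fun d : ℕ => (d : ℝ) ≤ L), (y - 1) ^ d.primeFactors.card

/-- Once-switched signed visible part:
`B_L(m) = ∑_{t ∣ m, t·L < m} ∑_{u ∣ m/t, t·u ≤ L} (y-2)^{ω(u)}`. -/
noncomputable def visB (y L : ℝ) (m : ℕ) : ℝ :=
  ∑ t ∈ m.divisors.filter (fun t : ℕ => (t : ℝ) * L < m),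
    ∑ u ∈ (m / t).divisors.filter (fun u : ℕ => ((t * u : ℕ) : ℝ) ≤ L), (y - 2) ^ u.primeFactors.card

/-- Twice-switched INVISIBLE remainder: pairs of small divisors `(t, v)` and the damped signed weight of
the second-generation cofactor `m/(t v)`:
`C_L(m) = ∑_{t ∣ m, tL < m} ∑_{v ∣ m/t, vL < m} (y-2)^{ω(m/(t v))}`. -/
noncomputable def invC (y L : ℝ) (m : ℕ) : ℝ :=
  ∑ t ∈ m.divisors.filter (fun t : ℕ => (t : ℝ) * L < m),
    ∑ v ∈ (m / t).divisors.filter (fun v : ℕ => (v : ℝ) * L < m),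
      (y - 2) ^ (m / (t * v)).primeFactors.card

/-- **Reflection identity** (card B, first lemma; finite combinatorics, squarefree case):
for squarefree `m ≥ 1`, real `y` and `L > 0`,
`y^{ω(m)} = A_L(m) + B_L(m) + C_L(m)`.
Proof sketch: `y^{ω} = ∑_{S ⊆ primes}(y-1)^{|S|}`; a subset with product `> L` is the complement of
`t` with `tL < m`; expand `(y-1)^{ω(m/t)} = ∑_{u ∣ m/t}(y-2)^{ω(u)}` and switch `u ↔ v = m/(tu)` on
`tu > L ⟺ vL < m`. -/
def ReflectionIdentity : Prop :=
  ∀ (y L : ℝ), 0 < L → ∀ m : ℕ, 0 < m → Squarefree m →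
    y ^ m.primeFactors.card = visA y L m + visB y L m + invC y L m

/-- The capped statistic of the route, for one integer value. -/
def sCap (m : ℕ) : ℕ := m.factorization.sum fun _ v => min v 2

/-- **Second-generation aggregate** (card B, the crux-let it exposes): along a Bateman–Horn system,
the twice-switched remainder at level `x^θ` (relative to the values) has an asymptotic of the SAME order
`x (log x)^{k(y-1)}` with some constant `c` — a damped (|y-2|<3/4) signed cofactor sum whose trivial
bound is `x(log x)^{k(3-y)}`, so the statement asks for a Halász-scale saving `(log x)^{k(4-2y)}`
with the constant.  (Squarefree-value version for simplicity of the sketch.) -/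
def SecondGenerationAggregate (k : ℕ) (f : Fin k → Polynomial ℤ) (y θ : ℝ) : Prop :=
  ∃ c : ℝ, Tendsto (fun x : ℕ => (x : ℝ)⁻¹ * Real.log x ^ ((k : ℝ) * (1 - y)) *
      ∑ n ∈ Finset.range (x + 1), invC y ((x : ℝ) ^ θ) (∏ i, ((f i).eval (n : ℤ)).toNat))
    atTop (nhds c)

/-! ## Card A: sign-free asymptotic-sieve lab -/

/-- Number of sub-multisets of the cycle type of `σ` equal to the pattern `S`
(= `∏_j C(mult_j(cycleType σ), mult_j S)`). -/
def patternCount {n : ℕ} (S : Multiset ℕ) (σ : Equiv.Perm (Fin n)) : ℕ :=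
  ∏ j ∈ S.toFinset, (σ.cycleType.count j).choose (S.count j)

/-- **Sign-free slack** (card A, first lemma, model side): in `S_n` there are two probability weights
with the SAME expected pattern counts for every pattern of total size `≤ ν n` (Type-I data of relative
level `ν`) but DIFFERENT values of the positive LSD functional `E[y^{#cycles}]`.
(`#cycles = card cycleType + #fixed points`; we use `cycleType.card + (n - cycleType.sum)`.)
The LP of kit job j006723 computes the optimal gap for n ≤ 24. -/
def SignFreeSlack (n : ℕ) (ν y : ℝ) : Prop :=
  ∃ w₁ w₂ : Equiv.Perm (Fin n) → ℝ,
    (∀ σ, 0 ≤ w₁ σ) ∧ (∀ σ, 0 ≤ w₂ σ) ∧ ∑ σ, w₁ σ = 1 ∧ ∑ σ, w₂ σ = 1 ∧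
    (∀ S : Multiset ℕ, ((S.sum : ℕ) : ℝ) ≤ ν * n →
        ∑ σ, w₁ σ * patternCount S σ = ∑ σ, w₂ σ * patternCount S σ) ∧
    (∑ σ, w₁ σ * y ^ (σ.cycleType.card + (n - σ.cycleType.sum)) ≠
      ∑ σ, w₂ σ * y ^ (σ.cycleType.card + (n - σ.cycleType.sum)))

/-- Pairs `(n, p)`, `n ≤ x`, `p` prime in `(x^α, x^β]`, `p ∣ f_i(n)` for some `i` (counted over `i`). -/
noncomputable def largePrimePairs (k : ℕ) (f : Fin k → Polynomial ℤ) (α β : ℝ) (x : ℕ) : ℕ :=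
  ∑ i : Fin k, ∑ n ∈ Finset.range (x + 1),
    ((Finset.range (Nat.floor ((x : ℝ) ^ β) + 1)).filter fun p : ℕ =>
      p.Prime ∧ (x : ℝ) ^ α < p ∧ (p : ℤ) ∣ (f i).eval (n : ℤ)).card

/-- **One-point law in the VISIBLE range** (card A; provable from Type-I + Mertens along `f`):
for `0 < α < β < 1`, `x⁻¹ · #{(i,n,p)} → k·log(β/α)`. -/
def OnePointLawVisible (k : ℕ) (f : Fin k → Polynomial ℤ) (α β : ℝ) : Prop :=
  Tendsto (fun x : ℕ => (x : ℝ)⁻¹ * (largePrimePairs k f α β x : ℝ)) atTop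
    (nhds ((k : ℝ) * Real.log (β / α)))

/-- **One-point law BEYOND the level** (Chebyshev–Hooley rung; the first invisible input the lab prices):
for a single irreducible `f = f₀` of degree `d` and `1 ≤ α < β ≤ d`,
`x⁻¹ · #{(n,p) : p ∈ (x^α, x^β], p ∣ f(n)} → log(β/α)` (Dickman/PD one-point function `dt/t`). OPEN for
every `f` of degree ≥ 2 and every `β > α ≥ 1` (only Ω-type lower bounds: DI82, dlBD20, Merikoski23). -/
def OnePointLawBeyond (k : ℕ) (f : Fin k → Polynomial ℤ) (α β : ℝ) : Prop :=
  Tendsto (fun x : ℕ => (x : ℝ)⁻¹ * (largePrimePairs k f α β x : ℝ)) atTop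
    (nhds ((k : ℝ) * Real.log (β / α)))

/-- **Two-sided LSD bracket** (card A, theorem-candidate shape): the normalised crux quantity is
eventually within `[c⁻, c⁺]`; the lab computes the OPTIMAL `c±(y)` certifiable from given Type-I/II
data (for `X²+1` at level `x`: `c⁻/model ≥ 2^{1-y}` from truncation alone). -/
def LSDBracket (k : ℕ) (f : Fin k → Polynomial ℤ) (y cm cp : ℝ) : Prop :=
  ∀ᶠ x : ℕ in atTop,
    cm ≤ (x : ℝ)⁻¹ * Real.log x ^ ((k : ℝ) * (1 - y)) *
        ∑ n ∈ Finset.range (x + 1), y ^ (∑ i, sCap (((f i).eval (n : ℤ)).toNat)) ∧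
    (x : ℝ)⁻¹ * Real.log x ^ ((k : ℝ) * (1 - y)) *
        ∑ n ∈ Finset.range (x + 1), y ^ (∑ i, sCap (((f i).eval (n : ℤ)).toNat)) ≤ cp

/-- Sanity link to the route: the crux decl is in scope. -/
example : Prop := Summit.Parity.BatemanHorn.Theses.AlmostPrimeZeros.SystemLSDRealSegment

end Summit.Parity.BatemanHorn.Cruxes.SystemLSDRealSegment.Sketch
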